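/-
Origin: expansion seat `planner-pub-hodgecm-toy-g2-0`, handover #6 v2 2026-08-18T06:43:40Z (`HOME/pub-hodgecm-toy-g2/lean/ToyG2/EquivRepr.lean`, md5 669b10f1, 304 lines);
landed by the gen-7 packager in gate run 25 as `HodgeCM/Model/ToyG2/EquivRepr.lean` (verbatim).
-/
/-
Copyright (c) 2026. All rights reserved.
Released under Apache 2.0 license as described in the file LICENSE.
-/
import Mathlib

/-!
# ToyG2.EquivRepr — representing a functional through a (possibly degenerate) pairing,
# the canonical `S`-orthogonal representative, and its invariance

Pure linear algebra over a field `𝕜` (Mathlib only).  This is the engine of the Gysin axiom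
(`Fact_gysin_surface`) for the gen-2 consistency model (`HOME/pub-hodgecm-toy-g2/DESIGN.md` §7):
there the pairing `P` is `(y, z) ↦ tr_X (y ∪ z)` on `H⁴(X) × H^{2d-4}(X)` (degenerate when `X` has a
Picard-modular block), the functional is `φ = tr_S ∘ f^*`, `S` is a rational positive-definite
"Hodge metric", and the symmetries `(gV, gW)` are the circle of the Deligne torus; the invariance
theorem then says that the canonical representative is a Hodge class.

* `rightRad P`                 : the right radical `{w | ∀ v, P v w = 0}`.
* `exists_repr`                : a functional `φ` on `V` vanishing on the left radical of
                                 `P : V → W → 𝕜` is of the form `P · c` (`W` finite-dimensional).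
* `existsUnique_repr`          : if a reflexive bilinear form `S` on `W` is nondegenerate on
                                 `rightRad P`, there is a UNIQUE such `c` that is `S`-orthogonal
                                 to `rightRad P`; `repr` is that element (`repr_spec`,
                                 `repr_mem_orthogonal`, `repr_unique`).
* `repr_invariant`             : every pair of automorphisms `(gV, gW)` preserving `P`, `S` and
                                 `φ` fixes `repr`.
* `mem_orthogonal_rightRad_iff`: (`V`, `W` finite-dimensional)
                                 `c ⊥_S rightRad P ↔ ∃ v₀, ∀ w, S w c = P v₀ w` — the form of the
                                 side condition that is stable under extension of scalars.
* `restrict_rightRad_nondegenerate_of_anisotropic`: an `S` anisotropic on the right radical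
                                 (e.g. positive definite) satisfies the hypothesis of `repr`.
* `IsCanonRepr`, `IsCanonRepr.unique`, `.map_equiv`, `.fixed`, `exists_isCanonRepr`: the same,
                                 packaged in the scalar-extension-stable form, with uniqueness
                                 from a `σ`-anisotropy (`σ =` complex conjugation after base
                                 change to `ℂ`) — no finite-dimensionality needed there.
-/

namespace HodgeCM.ToyG2

open Module

variable {𝕜 : Type*} [Field 𝕜] {V W : Type*} [AddCommGroup V] [Module 𝕜 V]
  [AddCommGroup W] [Module 𝕜 W]

/-- The right radical of a pairing `P : V → W → 𝕜`. -/
def rightRad (P : V →ₗ[𝕜] W →ₗ[𝕜] 𝕜) : Submodule 𝕜 W := LinearMap.ker P.flip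

/-- (Ported verbatim from the HodgeCMPerL package; no docstring in the source.) -/
theorem mem_rightRad_iff (P : V →ₗ[𝕜] W →ₗ[𝕜] 𝕜) (w : W) :
    w ∈ rightRad P ↔ ∀ v, P v w = 0 := by
  simp only [rightRad, LinearMap.mem_ker, LinearMap.ext_iff, LinearMap.flip_apply,
    LinearMap.zero_apply]

/-- The left radical of `P` is the kernel of `P : V → Dual W`. -/
theorem mem_ker_iff (P : V →ₗ[𝕜] W →ₗ[𝕜] 𝕜) (v : V) :
    v ∈ LinearMap.ker P ↔ ∀ w, P v w = 0 := by
  simp only [LinearMap.mem_ker, LinearMap.ext_iff, LinearMap.zero_apply]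

section Repr

variable [FiniteDimensional 𝕜 W]

/-- A functional vanishing on the left radical of `P` is represented through `P`. -/
theorem exists_repr (P : V →ₗ[𝕜] W →ₗ[𝕜] 𝕜) (φ : Module.Dual 𝕜 V)
    (hφ : ∀ v, (∀ w, P v w = 0) → φ v = 0) : ∃ c : W, ∀ v, P v c = φ v := by
  have hmem : φ ∈ LinearMap.range P.dualMap := by
    rw [LinearMap.range_dualMap_eq_dualAnnihilator_ker, Submodule.mem_dualAnnihilator]
    intro v hv
    exact hφ v ((mem_ker_iff P v).mp hv)
  obtain ⟨ψ, hψ⟩ := hmem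
  refine ⟨(Module.evalEquiv 𝕜 W).symm ψ, fun v => ?_⟩
  rw [Module.apply_evalEquiv_symm_apply, ← hψ, LinearMap.dualMap_apply]

variable (P : V →ₗ[𝕜] W →ₗ[𝕜] 𝕜) (S : LinearMap.BilinForm 𝕜 W) (hS : S.IsRefl)
  (hSR : (S.restrict (rightRad P)).Nondegenerate) (φ : Module.Dual 𝕜 V)
  (hφ : ∀ v, (∀ w, P v w = 0) → φ v = 0)

include hS hSR hφ in
/-- With a reflexive form `S` nondegenerate on the right radical, the representative that is
`S`-orthogonal to the right radical exists and is unique. -/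
theorem existsUnique_repr :
    ∃! c : W, (∀ v, P v c = φ v) ∧ c ∈ S.orthogonal (rightRad P) := by
  obtain ⟨c₀, hc₀⟩ := exists_repr P φ hφ
  have hcompl : IsCompl (rightRad P) (S.orthogonal (rightRad P)) :=
    (LinearMap.BilinForm.restrict_nondegenerate_iff_isCompl_orthogonal hS).mp hSR
  have hmem : c₀ ∈ rightRad P ⊔ S.orthogonal (rightRad P) := by
    rw [hcompl.sup_eq_top]; exact Submodule.mem_top
  obtain ⟨r, hr, c, hc, hsum⟩ := Submodule.mem_sup.mp hmem
  have hcφ : ∀ v, P v c = φ v := by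
    intro v
    have h := hc₀ v
    rw [← hsum, map_add, (mem_rightRad_iff P r).mp hr v, zero_add] at h
    exact h
  refine ⟨c, ⟨hcφ, hc⟩, ?_⟩
  rintro c' ⟨hc'φ, hc'⟩
  have h1 : c' - c ∈ rightRad P := by
    rw [mem_rightRad_iff]
    intro v
    rw [map_sub, hc'φ v, hcφ v, sub_self]
  have h2 : c' - c ∈ S.orthogonal (rightRad P) := Submodule.sub_mem _ hc' hc
  have h3 : c' - c ∈ (⊥ : Submodule 𝕜 W) :=
    hcompl.disjoint.le_bot (Submodule.mem_inf.mpr ⟨h1, h2⟩)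
  rw [Submodule.mem_bot] at h3
  exact sub_eq_zero.mp h3

/-- THE canonical representative of `φ` through `P`: `S`-orthogonal to the right radical. -/
noncomputable def repr : W := (existsUnique_repr P S hS hSR φ hφ).exists.choose

/-- (Ported verbatim from the HodgeCMPerL package; no docstring in the source.) -/
theorem repr_spec (v : V) : P v (repr P S hS hSR φ hφ) = φ v :=
  (existsUnique_repr P S hS hSR φ hφ).exists.choose_spec.1 v

/-- (Ported verbatim from the HodgeCMPerL package; no docstring in the source.) -/
theorem repr_mem_orthogonal : repr P S hS hSR φ hφ ∈ S.orthogonal (rightRad P) :=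
  (existsUnique_repr P S hS hSR φ hφ).exists.choose_spec.2

include hS hSR hφ in
/-- (Ported verbatim from the HodgeCMPerL package; no docstring in the source.) -/
theorem repr_unique (c : W) (h1 : ∀ v, P v c = φ v) (h2 : c ∈ S.orthogonal (rightRad P)) :
    c = repr P S hS hSR φ hφ :=
  (existsUnique_repr P S hS hSR φ hφ).unique ⟨h1, h2⟩
    ⟨repr_spec P S hS hSR φ hφ, repr_mem_orthogonal P S hS hSR φ hφ⟩

/-- **Invariance.** Automorphisms `gV`, `gW` preserving the pairing, the form `S` and the functional
`φ` fix the canonical representative. -/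
theorem repr_invariant (gV : V ≃ₗ[𝕜] V) (gW : W ≃ₗ[𝕜] W)
    (hP : ∀ v w, P (gV v) (gW w) = P v w) (hSg : ∀ w w', S (gW w) (gW w') = S w w')
    (hφg : ∀ v, φ (gV v) = φ v) :
    gW (repr P S hS hSR φ hφ) = repr P S hS hSR φ hφ := by
  symm
  refine (repr_unique P S hS hSR φ hφ _ ?_ ?_).symm
  · intro v
    obtain ⟨v', rfl⟩ := gV.surjective v
    rw [hP, repr_spec, hφg]
  · rw [LinearMap.BilinForm.mem_orthogonal_iff]
    intro n hn
    have hn' : gW.symm n ∈ rightRad P := by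
      rw [mem_rightRad_iff] at hn ⊢
      intro v
      have h := hP v (gW.symm n)
      rw [LinearEquiv.apply_symm_apply] at h
      rw [← h]
      exact hn (gV v)
    have h := (LinearMap.BilinForm.mem_orthogonal_iff.mp
      (repr_mem_orthogonal P S hS hSR φ hφ)) (gW.symm n) hn'
    calc S n (gW (repr P S hS hSR φ hφ))
        = S (gW (gW.symm n)) (gW (repr P S hS hSR φ hφ)) := by
          rw [LinearEquiv.apply_symm_apply]
      _ = S (gW.symm n) (repr P S hS hSR φ hφ) := hSg _ _
      _ = 0 := h

omit [FiniteDimensional 𝕜 W] in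
/-- The right radical is preserved by a pair of automorphisms preserving the pairing. -/
theorem rightRad_map_equiv (gV : V ≃ₗ[𝕜] V) (gW : W ≃ₗ[𝕜] W)
    (hP : ∀ v w, P (gV v) (gW w) = P v w) (w : W) (hw : w ∈ rightRad P) :
    gW w ∈ rightRad P := by
  rw [mem_rightRad_iff] at hw ⊢
  intro v
  obtain ⟨v', rfl⟩ := gV.surjective v
  rw [hP]
  exact hw v'

end Repr

section SideCondition

variable [FiniteDimensional 𝕜 V] [FiniteDimensional 𝕜 W]
  (P : V →ₗ[𝕜] W →ₗ[𝕜] 𝕜) (S : LinearMap.BilinForm 𝕜 W)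

omit [FiniteDimensional 𝕜 W] in
/-- The annihilator of the right radical is the range of `P : V → Dual W`. -/
theorem dualAnnihilator_rightRad :
    (rightRad P).dualAnnihilator = LinearMap.range P := by
  -- `rightRad P = ker P.flip`, and `P = P.flip.dualMap ∘ eval` up to the reflexivity isomorphism.
  have h := LinearMap.range_dualMap_eq_dualAnnihilator_ker P.flip
  rw [rightRad, ← h]
  apply le_antisymm
  · rintro ψ ⟨χ, rfl⟩
    refine ⟨(Module.evalEquiv 𝕜 V).symm χ, ?_⟩
    ext w
    rw [LinearMap.dualMap_apply]
    have := Module.apply_evalEquiv_symm_apply (f := P.flip w) (g := χ)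
    rw [LinearMap.flip_apply] at this
    exact this
  · rintro ψ ⟨v, rfl⟩
    refine ⟨Module.Dual.eval 𝕜 V v, ?_⟩
    ext w
    rw [LinearMap.dualMap_apply, Module.Dual.eval_apply]
    rfl

omit [FiniteDimensional 𝕜 W] in
/-- Being `S`-orthogonal to the right radical of `P` is the scalar-extension-stable condition
`∃ v₀, ∀ w, S w c = P v₀ w` (for any bilinear form `S`; `V` finite-dimensional). -/
theorem mem_orthogonal_rightRad_iff (c : W) :
    c ∈ S.orthogonal (rightRad P) ↔ ∃ v₀ : V, ∀ w, S w c = P v₀ w := by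
  constructor
  · intro hc
    -- the functional `S · c` kills `rightRad P`, so lies in its annihilator `= range P`
    have hmem : S.flip c ∈ (rightRad P).dualAnnihilator := by
      rw [Submodule.mem_dualAnnihilator]
      intro w hw
      exact (LinearMap.BilinForm.mem_orthogonal_iff.mp hc) w hw
    rw [dualAnnihilator_rightRad] at hmem
    obtain ⟨v₀, hv₀⟩ := hmem
    refine ⟨v₀, fun w => ?_⟩
    have := LinearMap.congr_fun hv₀ w
    rw [this]
    rfl
  · rintro ⟨v₀, hv₀⟩
    rw [LinearMap.BilinForm.mem_orthogonal_iff]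
    intro w hw
    rw [hv₀ w]
    exact (mem_rightRad_iff P w).mp hw v₀

omit [FiniteDimensional 𝕜 V] in
/-- If `S` is nondegenerate on `W` and `S w w = 0 → w = 0` holds on the right radical (e.g. `S`
positive definite over an ordered field), then `S` restricted to the right radical is
nondegenerate — the hypothesis of `existsUnique_repr`. -/
theorem restrict_rightRad_nondegenerate_of_anisotropic
    (hA : ∀ w ∈ rightRad P, S w w = 0 → w = 0) :
    (S.restrict (rightRad P)).Nondegenerate := by
  -- an anisotropic form on a finite-dimensional space is nondegenerate
  refine (LinearMap.BilinForm.nondegenerate_iff_ker_eq_bot).mpr ?_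
  rw [Submodule.eq_bot_iff]
  intro x hx
  rw [LinearMap.mem_ker] at hx
  have h0 : S x.1 x.1 = 0 := by
    have := LinearMap.congr_fun hx x
    simpa using this
  exact Subtype.ext (hA x.1 x.2 h0)

end SideCondition

section Canon

/-! ### The scalar-extension-stable packaging

`IsCanonRepr P S φ c` packages the two conditions in the form `(∀ v, P v c = φ v) ∧
(∃ v₀, ∀ w, S w c = P v₀ w)`, which passes to any extension of scalars by linearity.  Uniqueness
is then proved from a *`σ`-anisotropy* of `S` (`S x (σ x) = 0 → x = 0` for some map `σ : W → W`
preserving the right radical) — over `ℚ` take `σ = id` and `S` positive definite; over `ℂ`, for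
base-changed data, take `σ =` complex conjugation (then `S_ℂ x (σ x)` is the Hermitian square norm),
which preserves the right radical of a pairing defined over `ℚ`.  No finite-dimensionality and no
description of the right radical after base change is needed for uniqueness and invariance. -/

variable (P : V →ₗ[𝕜] W →ₗ[𝕜] 𝕜) (S : LinearMap.BilinForm 𝕜 W) (φ : Module.Dual 𝕜 V)

/-- `c` represents `φ` through `P`, and `S(·, c)` is of the form `P v₀`. -/
def IsCanonRepr (c : W) : Prop := (∀ v, P v c = φ v) ∧ ∃ v₀ : V, ∀ w, S w c = P v₀ w

variable {P S φ}

/-- Uniqueness of the canonical representative from `σ`-anisotropy. -/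
theorem IsCanonRepr.unique (σ : W → W) (hσ : ∀ w ∈ rightRad P, σ w ∈ rightRad P)
    (hS : ∀ x y, S x y = S y x) (hA : ∀ x, S x (σ x) = 0 → x = 0) {c c' : W}
    (hc : IsCanonRepr P S φ c) (hc' : IsCanonRepr P S φ c') : c = c' := by
  obtain ⟨h1, v₀, h2⟩ := hc
  obtain ⟨h1', v₀', h2'⟩ := hc'
  have hd : c - c' ∈ rightRad P := by
    rw [mem_rightRad_iff]
    intro v
    rw [map_sub, h1 v, h1' v, sub_self]
  have hSd : ∀ w, S w (c - c') = P (v₀ - v₀') w := by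
    intro w
    rw [map_sub, h2 w, h2' w, map_sub, LinearMap.sub_apply]
  have h0 : S (c - c') (σ (c - c')) = 0 := by
    rw [hS, hSd]
    exact (mem_rightRad_iff P _).mp (hσ _ hd) _
  exact sub_eq_zero.mp (hA _ h0)

/-- Invariance of the packaged conditions under automorphisms preserving `P`, `S`, `φ`. -/
theorem IsCanonRepr.map_equiv {c : W} (hc : IsCanonRepr P S φ c)
    (gV : V ≃ₗ[𝕜] V) (gW : W ≃ₗ[𝕜] W)
    (hP : ∀ v w, P (gV v) (gW w) = P v w) (hSg : ∀ w w', S (gW w) (gW w') = S w w')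
    (hφg : ∀ v, φ (gV v) = φ v) : IsCanonRepr P S φ (gW c) := by
  obtain ⟨h1, v₀, h2⟩ := hc
  refine ⟨fun v => ?_, ⟨gV v₀, fun w => ?_⟩⟩
  · obtain ⟨v', rfl⟩ := gV.surjective v
    rw [hP, h1, hφg]
  · obtain ⟨w', rfl⟩ := gW.surjective w
    rw [hSg, h2, hP]

/-- Hence: under `σ`-anisotropy, a canonical representative is FIXED by every such pair. -/
theorem IsCanonRepr.fixed (σ : W → W) (hσ : ∀ w ∈ rightRad P, σ w ∈ rightRad P)
    (hS : ∀ x y, S x y = S y x) (hA : ∀ x, S x (σ x) = 0 → x = 0) {c : W}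
    (hc : IsCanonRepr P S φ c) (gV : V ≃ₗ[𝕜] V) (gW : W ≃ₗ[𝕜] W)
    (hP : ∀ v w, P (gV v) (gW w) = P v w) (hSg : ∀ w w', S (gW w) (gW w') = S w w')
    (hφg : ∀ v, φ (gV v) = φ v) : gW c = c :=
  IsCanonRepr.unique σ hσ hS hA (hc.map_equiv gV gW hP hSg hφg) hc

variable (P S φ) [FiniteDimensional 𝕜 V] [FiniteDimensional 𝕜 W]

/-- Existence over the base field: the `repr` of the previous section is a canonical
representative (for `S` reflexive and nondegenerate on the right radical — e.g. anisotropic). -/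
theorem exists_isCanonRepr (hS : S.IsRefl) (hSR : (S.restrict (rightRad P)).Nondegenerate)
    (hφ : ∀ v, (∀ w, P v w = 0) → φ v = 0) : ∃ c : W, IsCanonRepr P S φ c :=
  ⟨repr P S hS hSR φ hφ, repr_spec P S hS hSR φ hφ,
    (mem_orthogonal_rightRad_iff P S _).mp (repr_mem_orthogonal P S hS hSR φ hφ)⟩

omit [FiniteDimensional 𝕜 W] in
/-- Conversely a canonical representative is `S`-orthogonal to the right radical. -/
theorem IsCanonRepr.mem_orthogonal {c : W} (hc : IsCanonRepr P S φ c) :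
    c ∈ S.orthogonal (rightRad P) :=
  (mem_orthogonal_rightRad_iff P S c).mpr hc.2

end Canon

end HodgeCM.ToyG2
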